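import Mathlib
import Summits.NavierStokesRegularity.NavierStokesRegularity.Theorems.WakeRatchetTailRatchetScalarFrontCompactness
import HarnessLib

/-!
# Scalar dyadic fronts (the construction `DyadicScalarFronts` of stmt-NavierStokesRegularity-21808):
# limits of fronts under CONTINUOUS convergence, and the a-priori derivative bound in a parameter box

Sequel to `WakeRatchetTailRatchetScalarFrontCompactness` (limits of fronts are fronts, stated there for
locally uniform convergence).  Here the same passage to the limit is proved under CONTINUOUS convergence
(`u_j → σ < 0 ⇒ a_j(u_j) → a(σ)`) to a limit continuous on `(−∞,0)` — exactly what an Arzelà–Ascoli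
extraction delivers (companion `WakeRatchetTailRatchetScalarFrontClosed`) — together with the uniform
derivative bound of bounded fronts in a parameter box that feeds the extraction:

* `hasDerivAt_of_frontLimit_cc`, `abs_le_of_pointwise`, `intervalIntegral_abs_le_of_pointwise`,
  `dyadicScalarFront_of_limit_cc` — the limit theorems under continuous / pointwise convergence
  (integral form + dominated convergence + fundamental theorem of calculus).
* `frontRHS_abs_le` — `|a| ≤ P`, `Λ' ∈ (Λ/2, 2Λ)`, `s' ∈ (s/2, 2s)` ⇒
  `|(Λ'/s'²)a(u/s')² − (s'/Λ')a(u)a(s'u)| ≤ (2Λ/(s/2)² + 2s/(Λ/2))P²` on `u < 0`.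

HONEST FRAMING: elementary real analysis about a MODEL lattice ODE (Tao 2016 §1.2, §4); nothing here
concerns the Navier–Stokes equations; no item is closed; `DyadicScalarFronts` at small `ε₀` stays open.
-/

noncomputable section

set_option linter.dupNamespace false

namespace Summit.NavierStokesRegularity.NavierStokesRegularity.Theorems

namespace WakeRatchetScalarFrontCompactness

open Set Filter Topology MeasureTheory intervalIntegral
open Literature.Analysis.FluidPDE Literature.Analysis.FluidPDE.TaoCascade

/-! ## Limits under continuous convergence -/

/-- **LIMITS OF FRONTS ARE FRONTS (the equation).**  Let `a_j : ℝ → ℝ` solve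
`a_j'(t) = (Λ_j/s_j²) a_j(t/s_j)² − (s_j/Λ_j) a_j(t) a_j(s_j t)` for `t < 0`, with `s_j > 0`,
`(Λ_j, s_j) → (Λ, s)`, `Λ > 0`, `s > 0`; suppose `|a_j| ≤ P` on `(−∞,0)` for all `j` and `a_j → a`
CONTINUOUSLY on `(−∞, 0)` (`u_j → σ < 0 ⇒ a_j(u_j) → a(σ)`, the output of the tree's Arzelà–Ascoli
extraction `exists_subseq_continuousLimit` of file `WakeRatchetExtractionAscoli`) with `a` continuous there.  Then `a`
solves `a'(t) = (Λ/s²) a(t/s)² − (s/Λ) a(t) a(st)` for every `t < 0`.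
[cite: Tao2016AveragedNS, §1.2 (dyadic model; its DSS front equation in the variables of the tree's `DyadicScalarFronts`); elementary (dominated convergence in the integral form, fundamental theorem of calculus)] -/
theorem hasDerivAt_of_frontLimit_cc {a : ℕ → ℝ → ℝ} {alim : ℝ → ℝ} {Λj sj : ℕ → ℝ} {Λ s P : ℝ}
    (hΛ : 0 < Λ) (hs : 0 < s) (hsj : ∀ j, 0 < sj j)
    (hΛlim : Tendsto Λj atTop (𝓝 Λ)) (hslim : Tendsto sj atTop (𝓝 s))
    (hode : ∀ j, ∀ t : ℝ, t < 0 → HasDerivAt (a j)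
      (Λj j / sj j ^ 2 * a j (t / sj j) ^ 2 - sj j / Λj j * a j t * a j (sj j * t)) t)
    (hbd : ∀ j, ∀ t : ℝ, t < 0 → |a j t| ≤ P)
    (hcc : ∀ (u : ℕ → ℝ) (σ : ℝ), σ < 0 → Tendsto u atTop (𝓝 σ) →
      Tendsto (fun j => a j (u j)) atTop (𝓝 (alim σ)))
    (hcont : ContinuousOn alim (Iio 0)) :
    ∀ t : ℝ, t < 0 → HasDerivAt alim
      (Λ / s ^ 2 * alim (t / s) ^ 2 - s / Λ * alim t * alim (s * t)) t := by
  -- continuity of every `a j` on `(−∞, 0)`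
  have hcontj : ∀ j, ContinuousOn (a j) (Iio 0) := fun j t ht =>
    (hode j t ht).continuousAt.continuousWithinAt
  have hP : 0 ≤ P := (abs_nonneg _).trans (hbd 0 (-1) (by norm_num))
  -- the right-hand sides
  set G : ℕ → ℝ → ℝ := fun j u =>
    Λj j / sj j ^ 2 * a j (u / sj j) ^ 2 - sj j / Λj j * a j u * a j (sj j * u) with hGdef
  set Glim : ℝ → ℝ := fun u => Λ / s ^ 2 * alim (u / s) ^ 2 - s / Λ * alim u * alim (s * u)
    with hGlimdef
  have hGcont : ∀ j, ContinuousOn (G j) (Iio 0) := fun j => frontRHS_continuousOn (hsj j) (hcontj j)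
  have hGlimcont : ContinuousOn Glim (Iio 0) := frontRHS_continuousOn hs hcont
  -- pointwise convergence of the right-hand sides on `(−∞, 0)`
  have hpt : ∀ u : ℝ, u < 0 → Tendsto (fun j => G j u) atTop (𝓝 (Glim u)) := by
    intro u hu
    have hus : u / s < 0 := div_neg_of_neg_of_pos hu hs
    have hsu : s * u < 0 := mul_neg_of_pos_of_neg hs hu
    -- `a j (u / sj j) → alim (u / s)`, `a j u → alim u`, `a j (sj j * u) → alim (s * u)`
    have h1 : Tendsto (fun j => a j (u / sj j)) atTop (𝓝 (alim (u / s))) :=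
      hcc _ _ hus (tendsto_const_nhds.div hslim hs.ne')
    have h2 : Tendsto (fun j => a j u) atTop (𝓝 (alim u)) := hcc _ _ hu tendsto_const_nhds
    have h3 : Tendsto (fun j => a j (sj j * u)) atTop (𝓝 (alim (s * u))) :=
      hcc _ _ hsu (hslim.mul tendsto_const_nhds)
    have hc1 : Tendsto (fun j => Λj j / sj j ^ 2) atTop (𝓝 (Λ / s ^ 2)) :=
      hΛlim.div (hslim.pow 2) (pow_ne_zero 2 hs.ne')
    have hc2 : Tendsto (fun j => sj j / Λj j) atTop (𝓝 (s / Λ)) := hslim.div hΛlim hΛ.ne'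
    simp only [hGdef, hGlimdef]
    exact (hc1.mul (h1.pow 2)).sub ((hc2.mul h2).mul h3)
  -- eventually the parameters are in a bounded box, so the right-hand sides are uniformly bounded
  have hevΛ : ∀ᶠ j in atTop, Λ / 2 < Λj j ∧ Λj j < 2 * Λ :=
    (hΛlim.eventually (Ioo_mem_nhds (by linarith) (by linarith))).mono fun j hj => hj
  have hevs : ∀ᶠ j in atTop, s / 2 < sj j ∧ sj j < 2 * s :=
    (hslim.eventually (Ioo_mem_nhds (by linarith) (by linarith))).mono fun j hj => hj
  set C : ℝ := (2 * Λ) / (s / 2) ^ 2 * P ^ 2 + (2 * s) / (Λ / 2) * P ^ 2 with hCdef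
  have hGbd : ∀ᶠ j in atTop, ∀ u : ℝ, u < 0 → |G j u| ≤ C := by
    filter_upwards [hevΛ, hevs] with j hΛj hsj' u hu
    have hus : u / sj j < 0 := div_neg_of_neg_of_pos hu (hsj j)
    have hsu : sj j * u < 0 := mul_neg_of_pos_of_neg (hsj j) hu
    have b1 := hbd j _ hus
    have b2 := hbd j _ hu
    have b3 := hbd j _ hsu
    have hΛjpos : 0 < Λj j := by linarith
    have hsjpos : 0 < sj j := hsj j
    have e1 : |Λj j / sj j ^ 2 * a j (u / sj j) ^ 2| ≤ (2 * Λ) / (s / 2) ^ 2 * P ^ 2 := by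
      rw [abs_mul, abs_of_pos (by positivity), abs_pow]
      have hc : Λj j / sj j ^ 2 ≤ (2 * Λ) / (s / 2) ^ 2 := by
        rw [div_le_div_iff₀ (by positivity) (by positivity)]
        have : (s / 2) ^ 2 ≤ sj j ^ 2 := by
          apply pow_le_pow_left₀ (by linarith) hsj'.1.le
        nlinarith [hΛj.2, this, sq_nonneg (sj j), hs]
      exact mul_le_mul hc (pow_le_pow_left₀ (abs_nonneg _) b1 2) (by positivity) (by positivity)
    have e2 : |sj j / Λj j * a j u * a j (sj j * u)| ≤ (2 * s) / (Λ / 2) * P ^ 2 := by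
      rw [abs_mul, abs_mul, abs_of_pos (by positivity), mul_assoc, sq]
      have hc : sj j / Λj j ≤ (2 * s) / (Λ / 2) := by
        rw [div_le_div_iff₀ hΛjpos (by positivity)]
        nlinarith [hsj'.2, hΛj.1, hs, hΛ]
      exact mul_le_mul hc (mul_le_mul b2 b3 (abs_nonneg _) hP) (by positivity) (by positivity)
    calc |G j u| ≤ |Λj j / sj j ^ 2 * a j (u / sj j) ^ 2| + |sj j / Λj j * a j u * a j (sj j * u)| :=
          abs_sub _ _
      _ ≤ C := by rw [hCdef]; exact add_le_add e1 e2
  -- the integral form passes to the limit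
  intro t ht
  set η : ℝ := -t / 2 with hη
  have hη0 : 0 < η := by rw [hη]; linarith
  have htη : t + η < 0 := by rw [hη]; linarith
  have hIoo : Ioo (t - η) (t + η) ⊆ Iio 0 := fun u hu => lt_trans hu.2 htη
  have hint : ∀ τ ∈ Ioo (t - η) (t + η), alim τ - alim t = ∫ u in t..τ, Glim u := by
    intro τ hτ
    have hseg : uIcc t τ ⊆ Iio 0 := by
      rcases le_total t τ with h | h
      · rw [uIcc_of_le h]; exact fun u hu => lt_of_le_of_lt hu.2 (hIoo hτ)
      · rw [uIcc_of_ge h]; exact fun u hu => lt_of_le_of_lt hu.2 ht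
    -- integral form for every `j`
    have hFTC : ∀ j, ∫ u in t..τ, G j u = a j τ - a j t := fun j =>
      integral_eq_sub_of_hasDerivAt (fun u hu => hode j u (hseg hu))
        ((hGcont j).mono hseg).intervalIntegrable
    -- dominated convergence
    have hDCT : Tendsto (fun j => ∫ u in t..τ, G j u) atTop (𝓝 (∫ u in t..τ, Glim u)) := by
      refine tendsto_integral_filter_of_dominated_convergence (fun _ => C) ?_ ?_ ?_ ?_
      · exact Eventually.of_forall fun j =>
          ((hGcont j).mono (uIoc_subset_uIcc.trans hseg)).aestronglyMeasurable measurableSet_uIoc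
      · filter_upwards [hGbd] with j hj
        exact Eventually.of_forall fun u hu => by
          rw [Real.norm_eq_abs]; exact hj u (hseg (uIoc_subset_uIcc hu))
      · exact intervalIntegrable_const
      · exact Eventually.of_forall fun u hu => hpt u (hseg (uIoc_subset_uIcc hu))
    have hlim2 : Tendsto (fun j => a j τ - a j t) atTop (𝓝 (alim τ - alim t)) :=
      (hcc _ _ (hIoo hτ) tendsto_const_nhds).sub (hcc _ _ ht tendsto_const_nhds)
    have hDCT' : Tendsto (fun j => a j τ - a j t) atTop (𝓝 (∫ u in t..τ, Glim u)) :=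
      hDCT.congr fun j => hFTC j
    exact tendsto_nhds_unique hlim2 hDCT'
  -- fundamental theorem of calculus at `t`
  have hFTC2 : HasDerivAt (fun τ => ∫ u in t..τ, Glim u) (Glim t) t :=
    integral_hasDerivAt_right IntervalIntegrable.refl
      (hGlimcont.stronglyMeasurableAtFilter isOpen_Iio t ht)
      (hGlimcont.continuousAt (Iio_mem_nhds ht))
  have hev : alim =ᶠ[𝓝 t] fun τ => alim t + ∫ u in t..τ, Glim u := by
    filter_upwards [Ioo_mem_nhds (show t - η < t by linarith) (show t < t + η by linarith)] with τ hτ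
    rw [← hint τ hτ]; ring
  have h := (hFTC2.const_add (alim t)).congr_of_eventuallyEq hev
  simpa only [hGlimdef] using h


/-- **The uniform sup bound passes to the limit.** [folklore] -/
theorem abs_le_of_pointwise {a : ℕ → ℝ → ℝ} {alim : ℝ → ℝ} {P : ℝ} {S : Set ℝ}
    (hbd : ∀ j, ∀ t ∈ S, |a j t| ≤ P) (hpt : ∀ t ∈ S, Tendsto (fun j => a j t) atTop (𝓝 (alim t))) :
    ∀ t ∈ S, |alim t| ≤ P := fun t ht =>
  le_of_tendsto' ((continuous_abs.tendsto _).comp (hpt t ht)) fun j => hbd j t ht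

/-- **The uniform mass bound passes to the limit**: if `∫_A^b |a_j| ≤ 𝓜` for all `j` (`A ≤ b < 0`),
`|a_j| ≤ P` on `(−∞,0)` and `a_j → a` pointwise on `(−∞,0)`, then `∫_A^b |a| ≤ 𝓜`
(dominated convergence on the compact interval). [folklore] -/
theorem intervalIntegral_abs_le_of_pointwise {a : ℕ → ℝ → ℝ} {alim : ℝ → ℝ} {P 𝓜 A b : ℝ}
    (hAb : A ≤ b) (hb : b < 0) (hcontj : ∀ j, ContinuousOn (a j) (Iio 0))
    (hbd : ∀ j, ∀ t : ℝ, t < 0 → |a j t| ≤ P) (hmass : ∀ j, ∫ u in A..b, |a j u| ≤ 𝓜)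
    (hpt : ∀ t : ℝ, t < 0 → Tendsto (fun j => a j t) atTop (𝓝 (alim t))) :
    ∫ u in A..b, |alim u| ≤ 𝓜 := by
  have hseg : uIcc A b ⊆ Iio 0 := by
    rw [uIcc_of_le hAb]; exact fun u hu => lt_of_le_of_lt hu.2 hb
  have hDCT : Tendsto (fun j => ∫ u in A..b, |a j u|) atTop (𝓝 (∫ u in A..b, |alim u|)) := by
    refine tendsto_integral_filter_of_dominated_convergence (fun _ => P) ?_ ?_ ?_ ?_
    · exact Eventually.of_forall fun j =>
        ((continuous_abs.comp_continuousOn ((hcontj j).mono (uIoc_subset_uIcc.trans hseg)))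
          ).aestronglyMeasurable measurableSet_uIoc
    · exact Eventually.of_forall fun j => Eventually.of_forall fun u hu => by
        rw [Real.norm_eq_abs, abs_abs]; exact hbd j u (hseg (uIoc_subset_uIcc hu))
    · exact intervalIntegrable_const
    · exact Eventually.of_forall fun u hu =>
        (continuous_abs.tendsto _).comp (hpt u (hseg (uIoc_subset_uIcc hu)))
  exact le_of_tendsto' hDCT hmass

/-- **A LIMIT OF FRONTS IS A FRONT (the clauses of `DyadicScalarFronts` at the limit parameters).**
Let `a_j` solve the scalar front equation with parameters `(Λ_j, s_j)`, `s_j > 0`,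
`(Λ_j, s_j) → (bigLam ε₀, s)` with `ε₀ > 0`, `s > 0`; suppose the family is uniformly bounded
(`|a_j| ≤ P` on `(−∞,0)`), has uniformly bounded mass (`∫_A^b |a_j| ≤ 𝓜` for `A ≤ b < 0`), a common
floor `a_j(t⋆) ≥ lo > 0` at one time `t⋆ < 0`, and converges continuously on `(−∞, 0)` to a
function `a` continuous there (the output of an Arzelà–Ascoli extraction).
Then `a` satisfies the four clauses of `WakeRatchetDyadicFront.DyadicScalarFronts` at `(ε₀, s)`: the
front equation on `t < 0`, integrability on `(−∞,0)`, boundedness near `0⁻`, non-triviality.  (The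
closedness half of a continuation of scalar fronts in the base; the equicontinuity feeding Arzelà–Ascoli
and the a-priori bounds are inputs, openness is not addressed.)
[cite: Tao2016AveragedNS, §1.2 (dyadic model; DSS front equation in the tree's variables); elementary] -/
theorem dyadicScalarFront_of_limit_cc {a : ℕ → ℝ → ℝ} {alim : ℝ → ℝ} {Λj sj : ℕ → ℝ}
    {ε₀ s P 𝓜 lo tstar : ℝ} (hε : 0 < ε₀) (hs : 0 < s) (hsj : ∀ j, 0 < sj j)
    (hΛlim : Tendsto Λj atTop (𝓝 (bigLam ε₀))) (hslim : Tendsto sj atTop (𝓝 s))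
    (hode : ∀ j, ∀ t : ℝ, t < 0 → HasDerivAt (a j)
      (Λj j / sj j ^ 2 * a j (t / sj j) ^ 2 - sj j / Λj j * a j t * a j (sj j * t)) t)
    (hbd : ∀ j, ∀ t : ℝ, t < 0 → |a j t| ≤ P)
    (hmass : ∀ j, ∀ A b : ℝ, A ≤ b → b < 0 → ∫ u in A..b, |a j u| ≤ 𝓜)
    (htstar : tstar < 0) (hlo : 0 < lo) (hfloor : ∀ j, lo ≤ a j tstar)
    (hcc : ∀ (u : ℕ → ℝ) (σ : ℝ), σ < 0 → Tendsto u atTop (𝓝 σ) →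
      Tendsto (fun j => a j (u j)) atTop (𝓝 (alim σ)))
    (hcont : ContinuousOn alim (Iio 0)) :
    (∀ t : ℝ, t < 0 → HasDerivAt alim
      (bigLam ε₀ / s ^ 2 * alim (t / s) ^ 2 - s / bigLam ε₀ * alim t * alim (s * t)) t) ∧
    IntegrableOn alim (Iio 0) ∧
    (∃ t₀ : ℝ, t₀ < 0 ∧ ∃ P' : ℝ, ∀ t : ℝ, t₀ ≤ t → t < 0 → |alim t| ≤ P') ∧
    ∃ t : ℝ, t < 0 ∧ alim t ≠ 0 := by
  have hΛ : 0 < bigLam ε₀ := bigLam_pos (by linarith)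
  have hcontj : ∀ j, ContinuousOn (a j) (Iio 0) := fun j t ht =>
    (hode j t ht).continuousAt.continuousWithinAt
  have hpt : ∀ t : ℝ, t < 0 → Tendsto (fun j => a j t) atTop (𝓝 (alim t)) := fun t ht =>
    hcc _ _ ht tendsto_const_nhds
  refine ⟨hasDerivAt_of_frontLimit_cc hΛ hs hsj hΛlim hslim hode hbd hcc hcont, ?_, ?_, ?_⟩
  · refine integrableOn_of_massBound (𝓜 := 𝓜) hcont fun A b hAb hb => ?_
    exact intervalIntegral_abs_le_of_pointwise hAb hb hcontj hbd (fun j => hmass j A b hAb hb) hpt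
  · exact ⟨-1, by norm_num, P, fun t _ ht =>
      abs_le_of_pointwise (S := Iio 0) (fun j t ht => hbd j t ht) (fun t ht => hpt t ht) t ht⟩
  · refine ⟨tstar, htstar, ?_⟩
    have h : lo ≤ alim tstar := ge_of_tendsto' (hpt tstar htstar) hfloor
    exact fun h0 => by rw [h0] at h; exact absurd h (not_le.2 hlo)

/-! ## A-priori derivative bound of a bounded front in a parameter box -/

/-- **Derivative bound.**  If `|a| ≤ P` on `(−∞,0)` and the parameters lie in the box
`Λ' ∈ (Λ/2, 2Λ)`, `s' ∈ (s/2, 2s)` (`Λ, s > 0`), then the front right-hand side obeys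
`|(Λ'/s'²)a(u/s')² − (s'/Λ')a(u)a(s'u)| ≤ (2Λ/(s/2)² + 2s/(Λ/2))·P²` for `u < 0`. [folklore] -/
theorem frontRHS_abs_le {a : ℝ → ℝ} {Λ s Λ' s' P : ℝ} (hΛ : 0 < Λ) (hs : 0 < s)
    (hΛ' : Λ / 2 < Λ' ∧ Λ' < 2 * Λ) (hs' : s / 2 < s' ∧ s' < 2 * s)
    (hbd : ∀ t : ℝ, t < 0 → |a t| ≤ P) {u : ℝ} (hu : u < 0) :
    |Λ' / s' ^ 2 * a (u / s') ^ 2 - s' / Λ' * a u * a (s' * u)|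
      ≤ (2 * Λ) / (s / 2) ^ 2 * P ^ 2 + (2 * s) / (Λ / 2) * P ^ 2 := by
  have hP : 0 ≤ P := (abs_nonneg _).trans (hbd u hu)
  have hΛ'pos : 0 < Λ' := by linarith [hΛ'.1]
  have hs'pos : 0 < s' := by linarith [hs'.1]
  have hus : u / s' < 0 := div_neg_of_neg_of_pos hu hs'pos
  have hsu : s' * u < 0 := mul_neg_of_pos_of_neg hs'pos hu
  have b1 := hbd _ hus
  have b2 := hbd _ hu
  have b3 := hbd _ hsu
  have e1 : |Λ' / s' ^ 2 * a (u / s') ^ 2| ≤ (2 * Λ) / (s / 2) ^ 2 * P ^ 2 := by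
    rw [abs_mul, abs_of_pos (by positivity), abs_pow]
    have hc : Λ' / s' ^ 2 ≤ (2 * Λ) / (s / 2) ^ 2 := by
      rw [div_le_div_iff₀ (by positivity) (by positivity)]
      have : (s / 2) ^ 2 ≤ s' ^ 2 := pow_le_pow_left₀ (by linarith) hs'.1.le 2
      nlinarith [hΛ'.2, this, sq_nonneg s', hs]
    exact mul_le_mul hc (pow_le_pow_left₀ (abs_nonneg _) b1 2) (by positivity) (by positivity)
  have e2 : |s' / Λ' * a u * a (s' * u)| ≤ (2 * s) / (Λ / 2) * P ^ 2 := by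
    rw [abs_mul, abs_mul, abs_of_pos (by positivity), mul_assoc, sq]
    have hc : s' / Λ' ≤ (2 * s) / (Λ / 2) := by
      rw [div_le_div_iff₀ hΛ'pos (by positivity)]
      nlinarith [hs'.2, hΛ'.1, hs, hΛ]
    exact mul_le_mul hc (mul_le_mul b2 b3 (abs_nonneg _) hP) (by positivity) (by positivity)
  calc |Λ' / s' ^ 2 * a (u / s') ^ 2 - s' / Λ' * a u * a (s' * u)|
      ≤ |Λ' / s' ^ 2 * a (u / s') ^ 2| + |s' / Λ' * a u * a (s' * u)| := abs_sub _ _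
    _ ≤ _ := add_le_add e1 e2

end WakeRatchetScalarFrontCompactness

end Summit.NavierStokesRegularity.NavierStokesRegularity.Theorems

end
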